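import Literature.MathematicalPhysics.QuantumFieldTheory.Borinsky2020.GeneralizedPermutahedronVertex
import Literature.MathematicalPhysics.QuantumFieldTheory.Borinsky2020.HeppSectorDecomposition
import HarnessLib

/-!
# The support function of a generalized permutahedron `𝒢_z` is the chain («Lovász») extension of `z`, hence CONVEX (Borinsky,
AIHPD 10 (2023) = arXiv:2008.12310, Lemma 26 glued over all Weyl chambers); and Lovász 1983's theorem «F is submodular ⇔ its
Lovász extension is convex» (as restated with proof in Bach 2013, Prop. 3.6) — PROVED, both directions

Sources. [Borinsky2020] M. Borinsky, "Tropical Monte Carlo quadrature for Feynman integrals", Ann. Inst. Henri Poincaré D 10 (2023)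
635–685 = arXiv:2008.12310v2, §6.1 (e-print flat numbering as in the companion file `GeneralizedPermutahedronVertex`, whose objects
`Supermodular`, `gpPolytope` = 𝒢_z of Theorem 23 eq. (39), `weylChamber` = C_σ of eq. (38), `chainSet` = A^σ_k, `ftVertex` = w^{(σ,z)}
of Lemma 26 eq. (41) this file reuses; journal numbering: Theorem 6.2 / Lemma 6.5, pp. 662–663), VERBATIM (tex l.1041–1057): "A vector
v ∈ 𝒢_z which maximizes all linear functionals in a Weyl chamber C_σ is a vertex of 𝒢_z. … **Lemma 26** ([Fujishige–Tomizawa 1983,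
Lemma 3.1, Lemma 3.2]). If z is a supermodular function z : 2^[n] → ℝ, σ ∈ S_n a permutation and w^{(σ,z)} ∈ ℝⁿ is the vector given
component-wise by w^{(σ,z)}_{σ(k)} = z(A^σ_k) − z(A^σ_{k−1}) for all k ∈ [n], (41) where A^σ_k = {σ(1), …, σ(k)} ⊂ [n], then w^{(σ,z)}
is a vertex of the generalized permutahedron 𝒢_z and ⟨y, w^{(σ,z)}⟩ = max_{v∈𝒢_z} ⟨y, v⟩ for all y ∈ C_σ". [Bach2013] F. Bach,
"Learning with Submodular Functions: A Convex Optimization Perspective", Found. Trends Mach. Learn. 6 (2013) 145–373 =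
arXiv:1111.6453v2 (PDF pages of v2 cited), VERBATIM: **Definition 2.1** (p.11) "A set-function F : 2^V → ℝ is submodular if and only
if, for all subsets A, B ⊂ V, we have: F(A) + F(B) ≥ F(A ∪ B) + F(A ∩ B)." with "F(∅) = 0 (which we will always assume)";
**Definition 2.2** (p.13) "B(F) = {s ∈ ℝ^p, s(V) = F(V), ∀A ⊂ V, s(A) ≤ F(A)}"; **Definition 3.1** (Lovász extension, p.18) "Given a
set-function F such that F(∅) = 0, the Lovász extension f : ℝ^p → ℝ is defined as follows; for w ∈ ℝ^p, order the components in
decreasing order w_{j_1} ≥ ⋯ ≥ w_{j_p} … f(w) = Σ_{k=1}^{p} w_{j_k} [F({j_1,…,j_k}) − F({j_1,…,j_{k−1}})] (3.1)"; **Proposition 3.1**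
(p.21) "(d) for all w ∈ ℝ^p and α ∈ ℝ, f(w + α1_V) = f(w) + αF(V), (e) the Lovász extension f is positively homogeneous, (f) for all
A ⊂ V, F(A) = f(1_A)"; **Proposition 3.2** (greedy algorithm, p.23) "… define s_{j_k} = F({j_1,…,j_k}) − F({j_1,…,j_{k−1}}). Then
s ∈ B(F) and … (b) s is a maximizer of max_{s∈B(F)} wᵀs, and max_{s∈B(F)} wᵀs = f(w)"; **Proposition 3.6** (p.25) "(Convexity and
submodularity) A set-function F is submodular if and only if its Lovász extension f is convex." with the proof "The vector
1_{A∪B} + 1_{A∩B} = 1_A + 1_B has components equal to 0 (on V∖(A ∪ B)), 2 (on A ∩ B) and 1 (on A △ B) … f(1_{A∪B} + 1_{A∩B}) = …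
= F(A ∪ B) + F(A ∩ B). Since f is convex, then by homogeneity, f(1_A + 1_B) ≤ f(1_A) + f(1_B), which is equal to F(A) + F(B), and
thus F is submodular. If we now assume that F is submodular, then by Prop. 3.2, f(w) is a maximum of linear functions, thus, it
is convex on ℝ^p", citing "[135] L. Lovász. Submodular functions and convexity. Mathematical programming: The state of the art,
Bonn, pages 235–257, 1982" (p.167) = [Lovasz1983] (Springer 1983, doi:10.1007/978-3-642-68874-4_10; the proposition number inside
Lovász's chapter is not verified here — no copy held). The same statement is Korte–Vygen, Combinatorial Optimization (6th ed.,
2018), Ch. 14 Exercise 10: "Prove that f is submodular if and only if f′ is convex. (Lovász [1983])".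

DICTIONARY (Borinsky ↔ Bach/Lovász, the one point a reader must not trip over): Borinsky's boolean functions are SUPERmodular and his
Weyl chamber (38) orders `y_{σ(1)} ≤ ⋯ ≤ y_{σ(n)}` (chain sets = LOWER level sets of y); Bach/Lovász's set functions are SUBmodular
and the chain runs through the UPPER level sets (`w_{j_1} ≥ ⋯ ≥ w_{j_p}`). With `F = −z`: Bach's base polytope is `B(F) = −𝒢_{−F}`
and the Lovász extension is `f_F(w) = h_{−F}(−w)` where `h_z(y) := max_{v ∈ 𝒢_z} ⟨y, v⟩` is the support function of 𝒢_z — so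
"z supermodular ⇒ h_z convex" (this file's `convexOn_gpSupport`) and "F submodular ⇒ f_F convex" (`convexOn_lovaszExt`) are the
same theorem, while the chain extension of a SUBmodular function along LOWER level sets would be concave.

TYPING / PROVED (ground set `[n]` = `Fin n`): `gpSupport z y` := `⟨y, w^{(σ_y,z)}⟩` with `σ_y = Tuple.sort y` (Mathlib's sorting
permutation, `y ∈ C_{σ_y}`: `mem_weylChamber_sort` from the companion file `HeppSectorDecomposition`); for supermodular `z` with `z(∅) = 0`: chamber independence
(`inner_ftVertex_eq_of_mem_weylChamber`, `gpSupport_eq_inner_ftVertex` — both sides equal Lemma 26's maximum), **`h_z(y) =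
max_{v∈𝒢_z} ⟨y,v⟩` for EVERY `y`** (`inner_le_gpSupport`, `isGreatest_gpSupport`), **convexity on ℝⁿ** (`convexOn_gpSupport`),
positive homogeneity (`gpSupport_smul`), `h_z(y + c𝟙) = h_z(y) + c z([n])` (`gpSupport_add_const`), the chain formula
(`gpSupport_eq_sum_range`; `gpSupport_eq_sum_range_sort` for any `z`). Standard orientation: `Submodular F` (Def. 2.1's inequality),
`supermodular_neg_iff`, `lovaszExt F w := gpSupport (−F) (−w)` with the printed chain formula (3.1) along any non-increasing ordering
(`lovaszExt_eq_sum_range`), Prop. 3.2 (b)'s bound `wᵀs ≤ f(w)` on `B(F)` (`inner_le_lovaszExt`), Prop. 3.1 (d)(e)(f)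
(`lovaszExt_add_const`, `lovaszExt_smul`, `lovaszExt_setIndicator` — the last for EVERY set function, as `f(1_A) = F(A) − F(∅)`),
the two-level evaluation of Prop. 3.6's proof (`lovaszExt_smul_setIndicator_add`: `f(c(1_A + 1_B)) = c(F(A∪B) + F(A∩B) − 2F(∅))`,
`c > 0`, any `F`), and **Proposition 3.6 both ways** (`convexOn_lovaszExt`, `submodular_of_convexOn_lovaszExt`,
`submodular_iff_convexOn_lovaszExt`, under `F(∅) = 0`). The counting lemma `chainSet_card_eq_of_lowerSet` (a strict lower set of a
sorted vector is an initial chain set) replaces Bach's level-set integrals (3.3)–(3.4). NOT typed: the integral representations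
(3.3)/(3.4), Prop. 3.2 (a) (the polymatroid P(F)), Prop. 3.7, and the identification of `h_z` with the tropical approximation
`p^tr` of a polynomial with Newton polytope 𝒢_z (Theorem 27's continuous part, see `GeneralizedPermutahedronVertex`).
(Filed by the pub-qed TROPICAL-track literature seat trop-lit g7 for `tropical/theory/T3-PAIRING.md` §19 (19b) Lemma S′, whose
certificate chain labels «λ_d convex for submodular d [PRINTED: Lovász 1983; Fujishige]»; `tropical/lit/SOURCES.md` §A8. VALUE-FREE.
independent recomputation; certified where stated, statistical where stated; no new-physics claim.)
-/

namespace Literature.MathematicalPhysics.QuantumFieldTheory.Borinsky2020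

open Finset

variable {n : ℕ}

/-- Chamber independence of Lemma 26's maximum: if `y ∈ C_σ ∩ C_τ` then `⟨y, w^{(σ,z)}⟩ = ⟨y, w^{(τ,z)}⟩` (both equal
`max_{v ∈ 𝒢_z} ⟨y, v⟩`). [cite: Borinsky2020, Lemma 26 (tex l.1043–1057)] -/
theorem inner_ftVertex_eq_of_mem_weylChamber {z : Finset (Fin n) → ℝ} (hz : Supermodular z) (h0 : z ∅ = 0)
    {σ τ : Equiv.Perm (Fin n)} {y : Fin n → ℝ} (hσ : y ∈ weylChamber σ) (hτ : y ∈ weylChamber τ) :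
    ∑ i, y i * ftVertex z σ i = ∑ i, y i * ftVertex z τ i :=
  le_antisymm (inner_le_inner_ftVertex h0 τ hτ (ftVertex_mem_gpPolytope hz h0 σ))
    (inner_le_inner_ftVertex h0 σ hσ (ftVertex_mem_gpPolytope hz h0 τ))

/-- The support function of `𝒢_z` computed through Lemma 26: `h_z(y) := ⟨y, w^{(σ_y, z)}⟩` with `σ_y = Tuple.sort y`
(on `C_σ` this is the chain sum `Σ_k y_{σ(k)} (z(A^σ_k) − z(A^σ_{k−1}))`, i.e. the Lovász / chain extension of `z` along the
LOWER level sets of `y`). [cite: Borinsky2020, Lemma 26 (tex l.1043–1057)] -/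
noncomputable def gpSupport (z : Finset (Fin n) → ℝ) (y : Fin n → ℝ) : ℝ :=
  ∑ i, y i * ftVertex z (Tuple.sort y) i

/-- `h_z(y) = ⟨y, w^{(σ,z)}⟩` for ANY `σ` with `y ∈ C_σ`. [cite: Borinsky2020, Lemma 26 (tex l.1043–1057)] -/
theorem gpSupport_eq_inner_ftVertex {z : Finset (Fin n) → ℝ} (hz : Supermodular z) (h0 : z ∅ = 0)
    {σ : Equiv.Perm (Fin n)} {y : Fin n → ℝ} (hy : y ∈ weylChamber σ) :
    gpSupport z y = ∑ i, y i * ftVertex z σ i :=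
  inner_ftVertex_eq_of_mem_weylChamber hz h0 (mem_weylChamber_sort y) hy

/-- `h_z(y) ≥ ⟨y, v⟩` for every `v ∈ 𝒢_z` (Lemma 26's maximisation, for all `y`). [cite: Borinsky2020, Lemma 26] -/
theorem inner_le_gpSupport {z : Finset (Fin n) → ℝ} (h0 : z ∅ = 0) {v : Fin n → ℝ} (hv : v ∈ gpPolytope z)
    (y : Fin n → ℝ) : ∑ i, y i * v i ≤ gpSupport z y :=
  inner_le_inner_ftVertex h0 (Tuple.sort y) (mem_weylChamber_sort y) hv

/-- … and the bound is attained inside `𝒢_z` (by `w^{(σ_y,z)}`), so `h_z(y) = max_{v ∈ 𝒢_z} ⟨y, v⟩`.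
[cite: Borinsky2020, Lemma 26 (tex l.1043–1057)] -/
theorem isGreatest_gpSupport {z : Finset (Fin n) → ℝ} (hz : Supermodular z) (h0 : z ∅ = 0) (y : Fin n → ℝ) :
    IsGreatest ((fun v : Fin n → ℝ => ∑ i, y i * v i) '' gpPolytope z) (gpSupport z y) := by
  refine ⟨⟨ftVertex z (Tuple.sort y), ftVertex_mem_gpPolytope hz h0 _, rfl⟩, ?_⟩
  rintro _ ⟨v, hv, rfl⟩
  exact inner_le_gpSupport h0 hv y

/-- **Convexity** (Lovász 1983, in Borinsky's orientation): for a supermodular `z` with `z(∅) = 0` the chain extension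
`y ↦ ⟨y, w^{(σ_y,z)}⟩` — the support function of the generalized permutahedron `𝒢_z` — is convex on `ℝⁿ`.
[cite: Bach2013, Prop. 3.6 second half (= Lovász 1983, ref. [135]), via Borinsky2020 Lemma 26] -/
theorem convexOn_gpSupport {z : Finset (Fin n) → ℝ} (hz : Supermodular z) (h0 : z ∅ = 0) :
    ConvexOn ℝ Set.univ (gpSupport z) := by
  refine ⟨convex_univ, ?_⟩
  intro x _ y _ a b ha hb _
  have hw := ftVertex_mem_gpPolytope hz h0 (Tuple.sort (a • x + b • y))
  have hx := inner_le_gpSupport h0 hw x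
  have hy := inner_le_gpSupport h0 hw y
  have hsplit : gpSupport z (a • x + b • y)
      = a * ∑ i, x i * ftVertex z (Tuple.sort (a • x + b • y)) i
        + b * ∑ i, y i * ftVertex z (Tuple.sort (a • x + b • y)) i := by
    unfold gpSupport
    simp only [Pi.add_apply, Pi.smul_apply, smul_eq_mul, mul_sum, ← sum_add_distrib]
    refine sum_congr rfl fun i _ => ?_
    ring
  rw [hsplit, smul_eq_mul, smul_eq_mul]
  exact add_le_add (mul_le_mul_of_nonneg_left hx ha) (mul_le_mul_of_nonneg_left hy hb)

/-- Positive homogeneity: `h_z(c y) = c h_z(y)` for `c ≥ 0`. [cite: Borinsky2020, Lemma 26] -/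
theorem gpSupport_smul {z : Finset (Fin n) → ℝ} (hz : Supermodular z) (h0 : z ∅ = 0) {c : ℝ} (hc : 0 ≤ c)
    (y : Fin n → ℝ) : gpSupport z (c • y) = c * gpSupport z y := by
  have hmem : c • y ∈ weylChamber (Tuple.sort y) := by
    intro j j' h
    simp only [Pi.smul_apply, smul_eq_mul]
    exact mul_le_mul_of_nonneg_left (mem_weylChamber_sort y j j' h) hc
  rw [gpSupport_eq_inner_ftVertex hz h0 hmem]
  unfold gpSupport
  simp only [Pi.smul_apply, smul_eq_mul, mul_sum]
  refine sum_congr rfl fun i _ => ?_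
  ring

/-- Translation along `𝟙`: `h_z(y + c𝟙) = h_z(y) + c z([n])` (so `h_z` descends to `ℝⁿ/𝟙ℝ` exactly when `z([n]) = 0`).
[cite: Borinsky2020, Lemma 26, Theorem 23 eq. (39)] -/
theorem gpSupport_add_const {z : Finset (Fin n) → ℝ} (hz : Supermodular z) (h0 : z ∅ = 0) (y : Fin n → ℝ) (c : ℝ) :
    gpSupport z (fun i => y i + c) = gpSupport z y + c * z univ := by
  have hmem : (fun i => y i + c) ∈ weylChamber (Tuple.sort y) := by
    intro j j' h
    show y _ + c ≤ y _ + c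
    linarith [mem_weylChamber_sort y j j' h]
  rw [gpSupport_eq_inner_ftVertex hz h0 hmem]
  unfold gpSupport
  simp only [add_mul, sum_add_distrib, ← mul_sum, sum_univ_ftVertex z _ h0]

/-! ## Chain formula and the values on indicator vectors -/

/-- `|A^σ_k| = k` for `k ≤ n`. Plumbing. [cite: Borinsky2020, Lemma 26 (tex l.1049)] -/
theorem card_chainSet (σ : Equiv.Perm (Fin n)) {k : ℕ} (hk : k ≤ n) : (chainSet σ k).card = k := by
  induction k with
  | zero => simp [chainSet_zero]
  | succ k ih =>
    have hk' : k < n := hk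
    rw [chainSet_succ σ hk', card_insert_of_notMem (apply_not_mem_chainSet σ hk'), ih hk'.le]

/-- If `y` is sorted by `σ` (`y ∈ C_σ`) and `S` is a strict lower set of `y` (`y_i < y_{i'}` whenever `i ∈ S`, `i' ∉ S`), then `S`
is the chain set `A^σ_{|S|}`: the sorted order lists `S` first. (Counting argument; used to evaluate the chain extension on
indicator vectors.) [cite: Bach2013, Prop. 3.1 (f)/(h) (the extension evaluated through the level sets of `w`)] -/
theorem chainSet_card_eq_of_lowerSet {σ : Equiv.Perm (Fin n)} {y : Fin n → ℝ} (hy : y ∈ weylChamber σ)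
    {S : Finset (Fin n)} (hS : ∀ i ∈ S, ∀ i' ∉ S, y i < y i') : chainSet σ S.card = S := by
  have hcard : S.card ≤ n := by simpa using S.card_le_univ
  apply eq_of_subset_of_card_le _ (by rw [card_chainSet σ hcard])
  intro i hi
  obtain ⟨j, rfl⟩ : ∃ j, σ j = i := ⟨σ.symm i, σ.apply_symm_apply i⟩
  have hj : (j : ℕ) < S.card := apply_mem_chainSet.mp hi
  by_contra hnot
  -- every later position is also outside `S`, so `S ⊆ A^σ_j`, contradicting `|A^σ_j| = j < |S|`
  have hsub : S ⊆ chainSet σ (j : ℕ) := by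
    intro s hs
    obtain ⟨j', rfl⟩ : ∃ j', σ j' = s := ⟨σ.symm s, σ.apply_symm_apply s⟩
    apply apply_mem_chainSet.mpr
    by_contra hge
    have hle : j ≤ j' := by
      rw [Fin.le_iff_val_le_val]; omega
    have h1 := hy j j' hle
    have h2 := hS (σ j') hs (σ j) hnot
    linarith
  have := card_le_card hsub
  rw [card_chainSet σ (le_of_lt j.isLt)] at this
  omega

/-- The chain formula behind `h_z`: for `y ∈ C_σ`,
`h_z(y) = Σ_{k<n} y_{σ(k+1)} · (z(A^σ_{k+1}) − z(A^σ_k))` (0-indexed positions). [cite: Borinsky2020, Lemma 26 eq. (41)] -/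
theorem gpSupport_eq_sum_range {z : Finset (Fin n) → ℝ} (hz : Supermodular z) (h0 : z ∅ = 0)
    {σ : Equiv.Perm (Fin n)} {y : Fin n → ℝ} (hy : y ∈ weylChamber σ) :
    gpSupport z y = ∑ m ∈ range n, alongChain σ y m * (z (chainSet σ (m + 1)) - z (chainSet σ m)) := by
  rw [gpSupport_eq_inner_ftVertex hz h0 hy, sum_univ_eq_sum_range σ]
  refine sum_congr rfl fun m hm => ?_
  rw [alongChain_mul, alongChain_ftVertex z σ (mem_range.mp hm)]

/-! ## Lovász 1983 in the standard orientation: SUBmodular set functions and UPPER level sets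

Bach 2013, Definition 3.1 (the «Lovász extension», there just «extension»): for `w ∈ ℝ^p` ordered as
`w_{j_1} ≥ ⋯ ≥ w_{j_p}`, `f(w) = Σ_{k=1}^{p} w_{j_k} [F({j_1,…,j_k}) − F({j_1,…,j_{k−1}})]`; Prop. 3.2: for submodular `F`,
`f(w) = max_{s ∈ B(F)} wᵀs` over the base polytope `B(F) = {s : s(A) ≤ F(A) ∀A, s(V) = F(V)}` (Edmonds' greedy algorithm);
Prop. 3.6 «(Convexity and submodularity) A set-function F is submodular if and only if its extension f is convex.» (Lovász 1983).
Dictionary to Borinsky's objects: `B(F) = −𝒢_{−F}` and `f(w) = h_{−F}(−w)`, `−F` supermodular ⇔ `F` submodular. -/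

/-- «F submodular»: `F(A ∩ B) + F(A ∪ B) ≤ F(A) + F(B)` for all `A, B`. [cite: Bach2013, Def. 2.1; Lovasz1983] -/
def Submodular (F : Finset (Fin n) → ℝ) : Prop :=
  ∀ A B : Finset (Fin n), F (A ∩ B) + F (A ∪ B) ≤ F A + F B

/-- `F` is submodular iff `−F` is supermodular (Borinsky's sign convention, Theorem 23 footnote). [cite: Borinsky2020, Theorem 23] -/
theorem supermodular_neg_iff {F : Finset (Fin n) → ℝ} : Supermodular (fun A => -F A) ↔ Submodular F := by
  constructor
  · intro h A B
    have := h A B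
    linarith
  · intro h A B
    have := h A B
    linarith

/-- The Lovász extension of a set function `F` on `[n]` (Bach 2013 Def. 3.1 / Lovász 1983), realised through Borinsky's
objects as `f(w) := h_{−F}(−w)`; see `lovaszExt_eq_sum_range` for the printed chain formula. [cite: Bach2013, Def. 3.1; Lovasz1983] -/
noncomputable def lovaszExt (F : Finset (Fin n) → ℝ) (w : Fin n → ℝ) : ℝ :=
  gpSupport (fun A => -F A) (-w)

/-- The printed chain formula: if `w` is non-increasing along `σ` (`w_{σ(1)} ≥ ⋯ ≥ w_{σ(n)}`, i.e. `−w ∈ C_σ`) then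
`f(w) = Σ_{k} w_{σ(k)} [F(A^σ_k) − F(A^σ_{k−1})]` (0-indexed positions). [cite: Bach2013, Def. 3.1 / Prop. 3.1 (h)] -/
theorem lovaszExt_eq_sum_range {F : Finset (Fin n) → ℝ} (hF : Submodular F) (h0 : F ∅ = 0)
    {σ : Equiv.Perm (Fin n)} {w : Fin n → ℝ} (hw : (-w) ∈ weylChamber σ) :
    lovaszExt F w = ∑ m ∈ range n, alongChain σ w m * (F (chainSet σ (m + 1)) - F (chainSet σ m)) := by
  have hz : Supermodular (fun A => -F A) := supermodular_neg_iff.mpr hF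
  have hz0 : (fun A => -F A) ∅ = 0 := by simp [h0]
  unfold lovaszExt
  rw [gpSupport_eq_sum_range hz hz0 hw]
  refine sum_congr rfl fun m hm => ?_
  have hm' := mem_range.mp hm
  rw [alongChain_of_lt σ _ hm', alongChain_of_lt σ _ hm']
  simp only [Pi.neg_apply]
  ring

/-- Edmonds' greedy bound in this orientation: `wᵀs ≤ f(w)` for every `s` in the base polytope
`B(F) = {s : s(A) ≤ F(A) ∀ A, s([n]) = F([n])}`. [cite: Bach2013, Prop. 3.2] -/
theorem inner_le_lovaszExt {F : Finset (Fin n) → ℝ} (h0 : F ∅ = 0) {s : Fin n → ℝ}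
    (hs : ∑ i, s i = F univ ∧ ∀ A : Finset (Fin n), ∑ i ∈ A, s i ≤ F A) (w : Fin n → ℝ) :
    ∑ i, w i * s i ≤ lovaszExt F w := by
  have hz0 : (fun A => -F A) ∅ = 0 := by simp [h0]
  have hmem : (fun i => -s i) ∈ gpPolytope (fun A => -F A) := by
    refine ⟨by simp [sum_neg_distrib, hs.1], fun A => ?_⟩
    simp only [sum_neg_distrib, neg_le_neg_iff]
    exact hs.2 A
  have h := inner_le_gpSupport hz0 hmem (-w)
  unfold lovaszExt
  refine le_trans (le_of_eq ?_) h
  simp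

/-- **Lovász 1983 (convexity direction), standard orientation**: the Lovász extension of a submodular `F` with `F(∅) = 0`
is a convex function on `ℝⁿ`. [cite: Bach2013, Prop. 3.6 (= Lovász 1983, ref. [135])] -/
theorem convexOn_lovaszExt {F : Finset (Fin n) → ℝ} (hF : Submodular F) (h0 : F ∅ = 0) :
    ConvexOn ℝ Set.univ (lovaszExt F) := by
  have hz : Supermodular (fun A => -F A) := supermodular_neg_iff.mpr hF
  have hz0 : (fun A => -F A) ∅ = 0 := by simp [h0]
  have hc := convexOn_gpSupport hz hz0
  refine ⟨convex_univ, ?_⟩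
  intro x _ y _ a b ha hb hab
  have h := hc.2 (Set.mem_univ (-x)) (Set.mem_univ (-y)) ha hb hab
  unfold lovaszExt
  have hneg : -(a • x + b • y) = a • (-x) + b • (-y) := by
    funext i; simp; ring
  rw [hneg]
  exact h

/-- Positive homogeneity `f(c w) = c f(w)`, `c ≥ 0`. [cite: Bach2013, Prop. 3.1 (b)] -/
theorem lovaszExt_smul {F : Finset (Fin n) → ℝ} (hF : Submodular F) (h0 : F ∅ = 0) {c : ℝ} (hc : 0 ≤ c)
    (w : Fin n → ℝ) : lovaszExt F (c • w) = c * lovaszExt F w := by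
  have hz : Supermodular (fun A => -F A) := supermodular_neg_iff.mpr hF
  have hz0 : (fun A => -F A) ∅ = 0 := by simp [h0]
  unfold lovaszExt
  rw [← gpSupport_smul hz hz0 hc, smul_neg]

/-- `f(w + c𝟙) = f(w) + c F([n])`. [cite: Bach2013, Prop. 3.1 (a)] -/
theorem lovaszExt_add_const {F : Finset (Fin n) → ℝ} (hF : Submodular F) (h0 : F ∅ = 0) (w : Fin n → ℝ) (c : ℝ) :
    lovaszExt F (fun i => w i + c) = lovaszExt F w + c * F univ := by
  have hz : Supermodular (fun A => -F A) := supermodular_neg_iff.mpr hF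
  have hz0 : (fun A => -F A) ∅ = 0 := by simp [h0]
  unfold lovaszExt
  have hneg : -(fun i => w i + c) = fun i => (-w) i + (-c) := by
    funext i; simp; ring
  rw [hneg, gpSupport_add_const hz hz0]
  ring

/-- The defining chain sum of `h_z`, valid for EVERY boolean function `z` (no supermodularity): with `σ₀ = Tuple.sort y`,
`h_z(y) = Σ_{k<n} y_{σ₀(k+1)} (z(A^{σ₀}_{k+1}) − z(A^{σ₀}_k))`. [cite: Borinsky2020, Lemma 26 eq. (41)] -/
theorem gpSupport_eq_sum_range_sort (z : Finset (Fin n) → ℝ) (y : Fin n → ℝ) :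
    gpSupport z y = ∑ m ∈ range n,
      alongChain (Tuple.sort y) y m * (z (chainSet (Tuple.sort y) (m + 1)) - z (chainSet (Tuple.sort y) m)) := by
  unfold gpSupport
  rw [sum_univ_eq_sum_range (Tuple.sort y)]
  refine sum_congr rfl fun m hm => ?_
  rw [alongChain_mul, alongChain_ftVertex z _ (mem_range.mp hm)]

/-- The indicator vector `1_A ∈ {0,1}ⁿ` of `A ⊂ [n]`. [cite: Bach2013, §3.1] -/
def setIndicator (A : Finset (Fin n)) (i : Fin n) : ℝ := if i ∈ A then 1 else 0

/-- Telescoping an indicator-weighted chain sum: if `A^σ_{|S|} = S` then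
`Σ_{k<n} 1_S(σ(k+1)) (G(k+1) − G(k)) = G(|S|) − G(0)`. Plumbing for the evaluations below.
[cite: Bach2013, Prop. 3.1 (f)/(h)] -/
theorem sum_range_setIndicator_chain (σ : Equiv.Perm (Fin n)) {S : Finset (Fin n)} (hS : chainSet σ S.card = S)
    (G : ℕ → ℝ) : ∑ m ∈ range n, alongChain σ (setIndicator S) m * (G (m + 1) - G m) = G S.card - G 0 := by
  have hcard : S.card ≤ n := by simpa using S.card_le_univ
  have hterm : ∀ m ∈ range n, alongChain σ (setIndicator S) m * (G (m + 1) - G m)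
      = if m < S.card then G (m + 1) - G m else 0 := by
    intro m hm
    have hm' := mem_range.mp hm
    have hiff : σ ⟨m, hm'⟩ ∈ S ↔ m < S.card := by
      have h := (apply_mem_chainSet (σ := σ) (k := S.card) (j := ⟨m, hm'⟩))
      rw [hS] at h
      exact h
    rw [alongChain_of_lt σ _ hm']
    by_cases h : m < S.card
    · simp [setIndicator, hiff.mpr h, h]
    · simp [setIndicator, mt hiff.mp h, h]
  rw [sum_congr rfl hterm, ← sum_range_add_sum_Ico _ hcard]
  have hIco : ∑ m ∈ Ico S.card n, (if m < S.card then G (m + 1) - G m else 0) = 0 := by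
    refine sum_eq_zero fun m hm => ?_
    have : ¬ m < S.card := by
      have := (mem_Ico.mp hm).1; omega
    simp [this]
  have hrange : ∑ m ∈ range S.card, (if m < S.card then G (m + 1) - G m else 0)
      = ∑ m ∈ range S.card, (G (m + 1) - G m) := by
    refine sum_congr rfl fun m hm => ?_
    simp [mem_range.mp hm]
  rw [hIco, add_zero, hrange, Finset.sum_range_sub]

/-- `f` IS an extension of `F`: `f(1_A) = F(A) − F(∅)` for EVERY set function `F` (so `= F(A)` under the standing
normalisation `F(∅) = 0`). [cite: Bach2013, Prop. 3.1 (f); Lovasz1983] -/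
theorem lovaszExt_setIndicator (F : Finset (Fin n) → ℝ) (A : Finset (Fin n)) :
    lovaszExt F (setIndicator A) = F A - F ∅ := by
  set w : Fin n → ℝ := setIndicator A with hwdef
  set σ := Tuple.sort (-w) with hσ
  have hy : (-w) ∈ weylChamber σ := mem_weylChamber_sort (-w)
  have hA : chainSet σ A.card = A := by
    refine chainSet_card_eq_of_lowerSet hy (fun i hi i' hi' => ?_)
    simp [hwdef, setIndicator, hi, hi']
  unfold lovaszExt
  rw [gpSupport_eq_sum_range_sort]
  have hterm : ∀ m ∈ range n,
      alongChain σ (-w) m * (-F (chainSet σ (m + 1)) - -F (chainSet σ m))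
        = alongChain σ (setIndicator A) m * (F (chainSet σ (m + 1)) - F (chainSet σ m)) := by
    intro m hm
    have hm' := mem_range.mp hm
    rw [alongChain_of_lt σ _ hm', alongChain_of_lt σ _ hm', hwdef]
    simp only [Pi.neg_apply]
    ring
  rw [sum_congr rfl hterm, sum_range_setIndicator_chain σ hA (fun m => F (chainSet σ m)), hA, chainSet_zero]

/-- The two-level evaluation used in Lovász's converse: for `c > 0`,
`f(c(1_A + 1_B)) = c (F(A ∪ B) + F(A ∩ B) − 2F(∅))` — the level sets of `1_A + 1_B` are `A ∩ B ⊂ A ∪ B`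
(Bach's «f(1_{A∪B} + 1_{A∩B}) = F(A ∪ B) + F(A ∩ B)»). [cite: Bach2013, proof of Prop. 3.6] -/
theorem lovaszExt_smul_setIndicator_add (F : Finset (Fin n) → ℝ) (A B : Finset (Fin n)) {c : ℝ} (hc : 0 < c) :
    lovaszExt F (fun i => c * (setIndicator A i + setIndicator B i))
      = c * (F (A ∪ B) + F (A ∩ B) - 2 * F ∅) := by
  set w : Fin n → ℝ := fun i => c * (setIndicator A i + setIndicator B i) with hwdef
  set σ := Tuple.sort (-w) with hσ
  have hy : (-w) ∈ weylChamber σ := mem_weylChamber_sort (-w)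
  have hAB : chainSet σ (A ∩ B).card = A ∩ B := by
    refine chainSet_card_eq_of_lowerSet hy (fun i hi i' hi' => ?_)
    rw [mem_inter] at hi
    rw [mem_inter, not_and_or] at hi'
    simp only [hwdef, Pi.neg_apply, setIndicator, hi.1, hi.2, if_true, neg_lt_neg_iff]
    rcases hi' with h | h
    · simp only [h, if_false]
      split_ifs <;> linarith
    · simp only [h, if_false]
      split_ifs <;> linarith
  have hAuB : chainSet σ (A ∪ B).card = A ∪ B := by
    refine chainSet_card_eq_of_lowerSet hy (fun i hi i' hi' => ?_)
    rw [mem_union] at hi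
    rw [mem_union, not_or] at hi'
    simp only [hwdef, Pi.neg_apply, setIndicator, hi'.1, hi'.2, if_false, neg_lt_neg_iff, add_zero, mul_zero]
    rcases hi with h | h
    · simp only [h, if_true]
      split_ifs <;> linarith
    · simp only [h, if_true]
      split_ifs <;> linarith
  -- pointwise `1_A + 1_B = 1_{A∪B} + 1_{A∩B}`
  have hsplit : ∀ i, setIndicator A i + setIndicator B i = setIndicator (A ∪ B) i + setIndicator (A ∩ B) i := by
    intro i
    simp only [setIndicator, mem_union, mem_inter]
    by_cases hA : i ∈ A <;> by_cases hB : i ∈ B <;> simp [hA, hB]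
  unfold lovaszExt
  rw [gpSupport_eq_sum_range_sort]
  have hterm : ∀ m ∈ range n,
      alongChain σ (-w) m * (-F (chainSet σ (m + 1)) - -F (chainSet σ m))
        = c * (alongChain σ (setIndicator (A ∪ B)) m * (F (chainSet σ (m + 1)) - F (chainSet σ m)))
          + c * (alongChain σ (setIndicator (A ∩ B)) m * (F (chainSet σ (m + 1)) - F (chainSet σ m))) := by
    intro m hm
    have hm' := mem_range.mp hm
    rw [alongChain_of_lt σ _ hm', alongChain_of_lt σ _ hm', alongChain_of_lt σ _ hm', hwdef]
    simp only [Pi.neg_apply, hsplit]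
    ring
  rw [sum_congr rfl hterm, sum_add_distrib, ← mul_sum, ← mul_sum,
    sum_range_setIndicator_chain σ hAuB (fun m => F (chainSet σ m)),
    sum_range_setIndicator_chain σ hAB (fun m => F (chainSet σ m)), hAuB, hAB, chainSet_zero]
  ring

/-- **Lovász 1983, converse direction**: if the Lovász extension of `F` (with `F(∅) = 0`) is convex then `F` is submodular
(convexity at the midpoint of `1_A`, `1_B`). [cite: Bach2013, Prop. 3.6 proof, first half (= Lovász 1983, ref. [135])] -/
theorem submodular_of_convexOn_lovaszExt {F : Finset (Fin n) → ℝ} (h0 : F ∅ = 0)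
    (hc : ConvexOn ℝ Set.univ (lovaszExt F)) : Submodular F := by
  intro A B
  have key := hc.2 (Set.mem_univ (setIndicator A)) (Set.mem_univ (setIndicator B))
    (show (0 : ℝ) ≤ 1 / 2 by norm_num) (show (0 : ℝ) ≤ 1 / 2 by norm_num) (show (1 / 2 : ℝ) + 1 / 2 = 1 by norm_num)
  have hmid : ((1 / 2 : ℝ) • setIndicator A + (1 / 2 : ℝ) • setIndicator B)
      = fun i => (1 / 2 : ℝ) * (setIndicator A i + setIndicator B i) := by
    funext i
    simp only [Pi.add_apply, Pi.smul_apply, smul_eq_mul]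
    ring
  rw [hmid, lovaszExt_smul_setIndicator_add F A B (by norm_num : (0 : ℝ) < 1 / 2), smul_eq_mul, smul_eq_mul,
    lovaszExt_setIndicator, lovaszExt_setIndicator, h0] at key
  linarith

/-- **Lovász 1983 / Bach 2013 Prop. 3.6 AS PRINTED**: «A set-function F is submodular if and only if its extension f is
convex.» (for set functions normalised by `F(∅) = 0`, on the ground set `[n]`).
[cite: Lovasz1983, pp. 235–257 (restated with proof as Bach2013 Prop. 3.6, arXiv:1111.6453v2 p.25)] -/
theorem submodular_iff_convexOn_lovaszExt {F : Finset (Fin n) → ℝ} (h0 : F ∅ = 0) :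
    Submodular F ↔ ConvexOn ℝ Set.univ (lovaszExt F) :=
  ⟨fun hF => convexOn_lovaszExt hF h0, fun hc => submodular_of_convexOn_lovaszExt h0 hc⟩

end Literature.MathematicalPhysics.QuantumFieldTheory.Borinsky2020
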